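import Literature.AlgebraicGeometry.HodgeTheory.GoursatKolchinRibetLieCore
import Literature.AlgebraicGeometry.HodgeTheory.GoursatKolchinRibetProjections
import Literature.AlgebraicGeometry.HodgeTheory.GlZariskiClosureMatrixBridge
import Mathlib.LinearAlgebra.Matrix.Dual
import HarnessLib

/-!
# The Goursat–Kolchin–Ribet criterion `Katz1990_goursatKolchinRibet_specialLinear'` PROVED modulo the
# classification of `Aut 𝔰𝔩ₙ` (Katz 1990, Prop. 1.8.2; Jacobson IX.5 Thm 5)

Layer `Literature/AlgebraicGeometry/HodgeTheory`. THEOREMS only. This file transports the matrix-side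
Goursat core `GoursatKolchinRibetLieCore.goursatCore_blockDiagonal` to the basis-free vocabulary of the named
fact `Katz1990_goursatKolchinRibet_specialLinear'` (`GoursatKolchinRibetCriterion`): choose bases `bᵢ` of the
`Eᵢ`, read `GL(⊕ Eᵢ)` in the product basis (`GlZariskiClosureMatrixBridge`: `glIdentityComponent ↔
identityComponent ∘ zariskiClosure`; `GoursatKolchinRibetKernels.toMatrix_blockDiagHom`: block-diagonal
families have block-diagonal matrices); hypothesis (1′) becomes the lift hypothesis of the core
(`GoursatKolchinRibetProjections.exists_blockDiagHom_mem_glIdentityComponent_of_mem`, "`G°` maps onto `Gᵢ°`");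
the KERNEL alternative of the core is a non-scalar element of Katz's block kernel `K_{i₀}` and the TWIST
alternatives contradict hypotheses (3)/(4) (a matrix `A` with `A δ_j^e = c_δ δ_{i₀} A`, resp.
`A (δ_j^e)^{−t} = c_δ δ_{i₀} A`, is the matrix of an isomorphism `E_j ≅ E_{i₀}`, resp. `E_j^∨ ≅ E_{i₀}`,
intertwining `ρ_j`, resp. `ρ_j^∨`, with `χ ⊗ ρ_{i₀}` on `H`). Hence every block kernel is non-scalar, and
`GoursatKolchinRibetKernels.Katz1990_goursatKolchinRibet_specialLinear'_of_kernels` yields the fact: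

* **`Katz1990_goursatKolchinRibet_specialLinear'_of_jacobson :
    Jacobson1962_sl_automorphisms.{0,0} → Katz1990_goursatKolchinRibet_specialLinear'`.**

So the Goursat–Kolchin–Ribet debt of crux K1 `VeryGeneralDeckCommutatorsInHg`
(`Summits/HodgeConjecture/HodgeConjecture/Theses/CyclicUnitaryPowers.lean`, `stmt-HodgeConjecture-19544`) is
reduced to the single cited fact `Jacobson1962_sl_automorphisms` (Jacobson, *Lie Algebras*, IX §5 Thm 5), whose
proof is in progress in the cell. Written by the prover seat `hodge-nonav-prover-Ax` (cell `hodge-nonav`).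

## References
* [Katz1990ESDE] N. M. Katz, *Exponential Sums and Differential Equations* (1990), §1.8 Prop. 1.8.2.
* [Jacobson1962LieAlgebras] N. Jacobson, *Lie Algebras* (1962), Ch. IX §5 Theorem 5.
* [SpringerLAG1998] T. A. Springer, *Linear Algebraic Groups*, 2nd ed. (1998), 2.2.5.
-/

noncomputable section

open scoped MatrixGroups

namespace Literature.AlgebraicGeometry.HodgeTheory

open Matrix Module Literature.NumberTheory.Automorphic Literature.AlgebraicGeometry.Motives

/-- The matrix of a linear map in re-indexed bases is the re-indexed matrix.
[cite: Katz1990ESDE, §1.8 Prop. 1.8.2 (proof)] -/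
private theorem toMatrix_reindex_reindex {R : Type*} [CommSemiring R] {M M' : Type*} [AddCommMonoid M] [Module R M]
    [AddCommMonoid M'] [Module R M'] {n n' l l' : Type*} [Fintype n] [DecidableEq n] [Fintype n'] [DecidableEq n']
    [Fintype l] [DecidableEq l] [Fintype l'] [DecidableEq l'] (b : Basis n R M) (c : Basis n' R M') (e : n ≃ l)
    (f : n' ≃ l') (u : M →ₗ[R] M') :
    LinearMap.toMatrix (b.reindex e) (c.reindex f) u = (LinearMap.toMatrix b c u).submatrix f.symm e.symm := by
  ext i j
  simp only [LinearMap.toMatrix_apply, Basis.reindex_apply, Basis.repr_reindex_apply, submatrix_apply]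

/-- **The Goursat–Kolchin–Ribet criterion (Katz 1990, Prop. 1.8.2, special case `Gᵢ^{0,der} = SL(Vᵢ)`, on
`ℂ`-points, hypothesis (1) on the projections) holds, given the classification of the automorphisms of
`𝔰𝔩ₙ(ℂ)`** (`Jacobson1962_sl_automorphisms`, Jacobson IX.5 Thm 5 — the "Goursat-adapted" input of Katz's
Examples 1.8.1). Proof = Katz's: reduction to the block kernels (`…_of_kernels`, Artin IV.4.9), "`G°` maps
onto `Gᵢ°`" (Springer 2.2.5), Lie algebras and Ribet's / Goursat's lemma (`goursatCore_blockDiagonal`), and the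
twists (3)/(4) read off through bases. [cite: Katz1990ESDE, §1.8 Prop. 1.8.2]
[cite: Jacobson1962LieAlgebras, Ch. IX §5 Theorem 5 (p. 283)] [cite: SpringerLAG1998, 2.2.5 (ii) and (iv)] -/
theorem Katz1990_goursatKolchinRibet_specialLinear'_of_jacobson
    (hJ : Literature.Algebra.Lie.SpecialLinearAutomorphisms.Jacobson1962_sl_automorphisms.{0, 0}) :
    Katz1990_goursatKolchinRibet_specialLinear' := by
  refine Katz1990_goursatKolchinRibet_specialLinear'_of_kernels ?_
  intro ι _ _ hι E _ _ _ hE H h1 h3 h4 i₀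
  classical
  -- bases, the product basis, the matrix isomorphism `Ψ`
  let d : ι → ℕ := fun i => finrank ℂ (E i)
  let b : ∀ i, Basis (Fin (d i)) ℂ (E i) := fun i => Module.finBasis ℂ (E i)
  let B : Basis (Σ i, Fin (d i)) ℂ (Π i, E i) := Pi.basis b
  obtain ⟨Ψ, hΨ⟩ := exists_mulEquiv_coe_eq_toMatrix B
  set Δ : Subgroup ((Π i, E i) ≃ₗ[ℂ] (Π i, E i)) := H.map (blockDiagHom E) with hΔ
  set ΔM : Subgroup (GL (Σ i, Fin (d i)) ℂ) := Δ.map Ψ.toMonoidHom with hΔM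
  have hbridge : ∀ g, g ∈ glIdentityComponent Δ ↔ Ψ g ∈ identityComponent (zariskiClosure ΔM) :=
    fun g => mem_glIdentityComponent_iff_mem_identityComponent B Ψ hΨ Δ g
  have hΨbd : ∀ s : Π i, (E i ≃ₗ[ℂ] E i), ((Ψ (blockDiagHom E s) : GL (Σ i, Fin (d i)) ℂ) : Matrix (Σ i, Fin (d i)) (Σ i, Fin (d i)) ℂ) =
      blockDiagonal' (m' := fun j => Fin (d j)) (n' := fun j => Fin (d j))
        fun j => LinearMap.toMatrix (b j) (b j) ((s j : E j ≃ₗ[ℂ] E j) : E j →ₗ[ℂ] E j) := by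
    intro s
    rw [hΨ]
    exact toMatrix_blockDiagHom b s
  have hΔMmem : ∀ δ ∈ ΔM, ∃ s ∈ H, Ψ (blockDiagHom E s) = δ := by
    rintro _ ⟨g, ⟨s, hs, rfl⟩, rfl⟩
    exact ⟨s, hs, rfl⟩
  have hΔMbd : ∀ δ ∈ ΔM, ∀ a c : Σ i, Fin (d i), a.1 ≠ c.1 → (δ : Matrix (Σ i, Fin (d i)) (Σ i, Fin (d i)) ℂ) a c = 0 := by
    intro δ hδ
    obtain ⟨s, -, rfl⟩ := hΔMmem δ hδ
    rw [hΨbd]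
    exact offDiag_blockDiagonal' _
  have hblk : ∀ s ∈ H, ∀ j, blockDiag' ((Ψ (blockDiagHom E s) : GL (Σ i, Fin (d i)) ℂ) : Matrix (Σ i, Fin (d i)) (Σ i, Fin (d i)) ℂ) j =
      LinearMap.toMatrix (b j) (b j) ((s j : E j ≃ₗ[ℂ] E j) : E j →ₗ[ℂ] E j) := by
    intro s _ j
    rw [hΨbd, blockDiag'_blockDiagonal']
  -- hypothesis (1′) in lift form on the matrix side ("`G°` maps onto `Gᵢ°`")
  have h1M : ∀ i (u : Matrix (Fin (d i)) (Fin (d i)) ℂ), u.det = 1 →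
      ∃ g ∈ identityComponent (zariskiClosure ΔM), blockDiag' (g : Matrix (Σ i, Fin (d i)) (Σ i, Fin (d i)) ℂ) i = u := by
    intro i u hu
    have hudet : IsUnit u.det := by rw [hu]; exact isUnit_one
    let v : E i ≃ₗ[ℂ] E i := Matrix.toLinearEquiv (b i) u hudet
    have hv : (v : E i →ₗ[ℂ] E i) = Matrix.toLin (b i) (b i) u := rfl
    have hvdet : LinearEquiv.det v = 1 := by
      apply Units.ext
      rw [LinearEquiv.coe_det, hv, LinearMap.det_toLin, hu, Units.val_one]
    obtain ⟨s, hs, hsi⟩ := exists_blockDiagHom_mem_glIdentityComponent_of_mem H i (h1 i v hvdet)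
    refine ⟨Ψ (blockDiagHom E s), (hbridge _).1 hs, ?_⟩
    rw [hΨbd, blockDiag'_blockDiagonal', hsi, hv, LinearMap.toMatrix_toLin]
  have hm : ∀ i, 2 ≤ Fintype.card (Fin (d i)) := fun i => by rw [Fintype.card_fin]; exact hE i
  -- the matrix core
  rcases goursatCore_blockDiagonal hJ hm ΔM hΔMbd h1M i₀ with ⟨g, hg, a, c, hac, hgE⟩ | ⟨j, hji, e, A, hA, htw⟩
  · -- the kernel alternative: a transvection in `K_{i₀}`
    have hg' : Ψ.symm g ∈ glIdentityComponent Δ := by rw [hbridge, MulEquiv.apply_symm_apply]; exact hg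
    obtain ⟨s, hs⟩ := exists_eq_blockDiagHom_of_mem_glZariskiClosure H (glIdentityComponent_subset_glZariskiClosure _ hg')
    have hsmat : (fun j => LinearMap.toMatrix (b j) (b j) ((s j : E j ≃ₗ[ℂ] E j) : E j →ₗ[ℂ] E j)) =
        1 + Pi.single (M := fun j => Matrix (Fin (d j)) (Fin (d j)) ℂ) i₀ (single a c (1 : ℂ)) := by
      apply blockDiagonal'_injective
      rw [blockDiagonal'_add, blockDiagonal'_one, ← hgE, ← hΨbd, hs, MulEquiv.apply_symm_apply]
    have hsj : ∀ j, LinearMap.toMatrix (b j) (b j) ((s j : E j ≃ₗ[ℂ] E j) : E j →ₗ[ℂ] E j) =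
        1 + Pi.single (M := fun j => Matrix (Fin (d j)) (Fin (d j)) ℂ) i₀ (single a c (1 : ℂ)) j :=
      fun j => congrFun hsmat j
    have hs1 : ∀ j, j ≠ i₀ → s j = 1 := by
      intro j hj
      have h := hsj j
      rw [Pi.single_eq_of_ne hj, add_zero, ← LinearMap.toMatrix_id (v₁ := b j)] at h
      refine LinearEquiv.ext fun x => ?_
      exact LinearMap.congr_fun ((LinearMap.toMatrix (b j) (b j)).injective h) x
    have hseq : s = Pi.mulSingle i₀ (s i₀) := by
      funext j
      by_cases hj : j = i₀
      · subst hj; rw [Pi.mulSingle_eq_same]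
      · rw [Pi.mulSingle_eq_of_ne hj, hs1 j hj]
    refine ⟨s i₀, ?_, fun c' hc' => ?_⟩
    · rw [← hseq, hs]; exact hg'
    · have h := hsj i₀
      rw [Pi.single_eq_same, hc', LinearEquiv.map_smul, LinearMap.toMatrix_id] at h
      have h2 := congrFun (congrFun h a) c
      rw [Matrix.smul_apply, Matrix.one_apply_ne hac, smul_zero, Matrix.add_apply, Matrix.one_apply_ne hac,
        zero_add, single_apply_same] at h2
      exact one_ne_zero h2.symm
  · -- the twist alternatives contradict (3) / (4)
    exfalso
    have hAA : A * A⁻¹ = 1 := mul_nonsing_inv A hA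
    have hA'A : A⁻¹ * A = 1 := nonsing_inv_mul A hA
    -- re-indexed basis of `E j` (indexed like `E i₀`)
    let bj : Basis (Fin (d i₀)) ℂ (E j) := (b j).reindex e
    have hbj : ∀ s : Π i, (E i ≃ₗ[ℂ] E i), LinearMap.toMatrix bj bj ((s j : E j ≃ₗ[ℂ] E j) : E j →ₗ[ℂ] E j) =
        (LinearMap.toMatrix (b j) (b j) ((s j : E j ≃ₗ[ℂ] E j) : E j →ₗ[ℂ] E j)).submatrix e.symm e.symm :=
      fun s => toMatrix_reindex_reindex (b j) (b j) e e _
    -- the scalar `χ` chosen from the twist relation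
    rcases htw with hplus | hminus
    · have hmemΔM : ∀ s ∈ H, Ψ (blockDiagHom E s) ∈ ΔM := fun s hs => ⟨blockDiagHom E s, ⟨s, hs, rfl⟩, rfl⟩
      let χ : (Π i, (E i ≃ₗ[ℂ] E i)) → ℂ := fun s =>
        if hs : s ∈ H then Classical.choose (hplus (Ψ (blockDiagHom E s)) (hmemΔM s hs)) else 0
      have hχ : ∀ s (hs : s ∈ H), A * (LinearMap.toMatrix (b j) (b j) ((s j : E j ≃ₗ[ℂ] E j) : E j →ₗ[ℂ] E j)).submatrix e.symm e.symm =
          χ s • (LinearMap.toMatrix (b i₀) (b i₀) ((s i₀ : E i₀ ≃ₗ[ℂ] E i₀) : E i₀ →ₗ[ℂ] E i₀) * A) := by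
        intro s hs
        have h := Classical.choose_spec (hplus (Ψ (blockDiagHom E s)) (hmemΔM s hs))
        simp only [χ, dif_pos hs]
        rw [← hblk s hs j, ← hblk s hs i₀]
        exact h
      -- the isomorphism `A' : E j ≅ E i₀` with matrix `A`
      let A' : E j ≃ₗ[ℂ] E i₀ := Matrix.toLinOfInv (v₁ := bj) (v₂ := b i₀) hAA hA'A
      have hA' : LinearMap.toMatrix bj (b i₀) (A' : E j →ₗ[ℂ] E i₀) = A := by
        change LinearMap.toMatrix bj (b i₀) (Matrix.toLin bj (b i₀) A) = A
        rw [LinearMap.toMatrix_toLin]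
      refine h3 j i₀ hji ⟨A', χ, fun s hs => ?_⟩
      apply (LinearMap.toMatrix bj (b i₀)).injective
      rw [LinearMap.toMatrix_comp bj bj (b i₀), LinearEquiv.map_smul, LinearMap.toMatrix_comp bj (b i₀) (b i₀), hA', hbj]
      exact hχ s hs
    · have hmemΔM : ∀ s ∈ H, Ψ (blockDiagHom E s) ∈ ΔM := fun s hs => ⟨blockDiagHom E s, ⟨s, hs, rfl⟩, rfl⟩
      let χ : (Π i, (E i ≃ₗ[ℂ] E i)) → ℂ := fun s =>
        if hs : s ∈ H then Classical.choose (hminus (Ψ (blockDiagHom E s)) (hmemΔM s hs)) else 0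
      have hχ : ∀ s (hs : s ∈ H), A * (((LinearMap.toMatrix (b j) (b j) ((s j : E j ≃ₗ[ℂ] E j) : E j →ₗ[ℂ] E j)).submatrix e.symm e.symm)ᵀ)⁻¹ =
          χ s • (LinearMap.toMatrix (b i₀) (b i₀) ((s i₀ : E i₀ ≃ₗ[ℂ] E i₀) : E i₀ →ₗ[ℂ] E i₀) * A) := by
        intro s hs
        have h := Classical.choose_spec (hminus (Ψ (blockDiagHom E s)) (hmemΔM s hs))
        simp only [χ, dif_pos hs]
        rw [← hblk s hs j, ← hblk s hs i₀]
        exact h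
      -- the isomorphism `A'' : (E j)^∨ ≅ E i₀` with matrix `A` in the dual basis
      let A'' : Module.Dual ℂ (E j) ≃ₗ[ℂ] E i₀ := Matrix.toLinOfInv (v₁ := bj.dualBasis) (v₂ := b i₀) hAA hA'A
      have hA'' : LinearMap.toMatrix bj.dualBasis (b i₀) (A'' : Module.Dual ℂ (E j) →ₗ[ℂ] E i₀) = A := by
        change LinearMap.toMatrix bj.dualBasis (b i₀) (Matrix.toLin bj.dualBasis (b i₀) A) = A
        rw [LinearMap.toMatrix_toLin]
      -- the matrix of `(s_j⁻¹)^∨` in the dual basis is `(s_j^e)ᵀ⁻¹`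
      have hdual : ∀ s : Π i, (E i ≃ₗ[ℂ] E i),
          LinearMap.toMatrix bj.dualBasis bj.dualBasis (((s j).symm : E j →ₗ[ℂ] E j).dualMap) =
            (((LinearMap.toMatrix (b j) (b j) ((s j : E j ≃ₗ[ℂ] E j) : E j →ₗ[ℂ] E j)).submatrix e.symm e.symm)ᵀ)⁻¹ := by
        intro s
        rw [LinearMap.dualMap_def, LinearMap.toMatrix_transpose, ← hbj, ← transpose_nonsing_inv]
        congr 1
        symm
        apply inv_eq_left_inv
        rw [← LinearMap.toMatrix_comp bj bj bj, ← LinearEquiv.coe_trans, LinearEquiv.self_trans_symm, LinearEquiv.refl_toLinearMap,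
          LinearMap.toMatrix_id]
      refine h4 j i₀ hji ⟨A'', χ, fun s hs => ?_⟩
      apply (LinearMap.toMatrix bj.dualBasis (b i₀)).injective
      rw [LinearMap.toMatrix_comp bj.dualBasis bj.dualBasis (b i₀), LinearEquiv.map_smul,
        LinearMap.toMatrix_comp bj.dualBasis (b i₀) (b i₀), hA'', hdual]
      exact hχ s hs

end Literature.AlgebraicGeometry.HodgeTheory

end
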